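import Summits.CriticalPhenomena.CardyFormulaZ2.Theorems.CardyBoundaryCoulombGasRectilinearCardyStubMatchingPart1
import Literature.Probability.LatticeModels.CollarLegModelRainbow

/-!
# Stub `stub_matching` of line `excursion-kernel-covariance` (crux `RectilinearCardy`,
# stmt-CriticalPhenomena-5660): the hull event of the `(1,3,1,1; 1)` walk is the row event

Geometry-free walk / graph combinatorics closing stub M of the line skeleton
`Cruxes/RectilinearCardy/Lines/excursion_kernel_covariance.lean` (Part 1: walk states, the
literal datum, cycle and placement facts, admissibility).

* `sm_startAt` — along the boundary cycle `e t = (dsucc V)^[t] d₀` the insertions of the placed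
  datum are met exactly at positions `0` (the sink, `(3, +1)`) and `iA, iB, iC` (`(1, -1)`);
* `sm_walk_state`, `sm_inWired1_iff`, `sm_inWired3_iff` — hence the states of the annotated walk
  are those of Part 1: the level `-1` wired set of the walk is the vertex block
  `{(e t).1 : iA ≤ t ≤ iB}`, the level `-3` wired set is `{X} ∪ {(e t).1 : iC ≤ t < period}`;
* `sm_step_adj`, `sm_hull_iff` — ABSTRACT MATCHING: a step of a path of live edges joins lattice
  neighbours in `V`; if the row sets `RA ⊆ W₁`, `RB ⊆ W₃` miss only vertices all of whose
  `V`-neighbours lie in the respective row set ("corners carry no connectivity"), corners of `W₁`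
  differ from `v'` and from `W₃`, corners of `W₃` differ from `RA`, then
  `{v' ↔ W₁} ∖ {W₃ ↔ W₁} = {v' ↔ RA} ∖ {RB ↔ RA}` (peel the last / first step of a path at a corner);
* `stub_matching` — the registered signature, assembled from these.
-/

namespace Summit.CriticalPhenomena.CardyFormulaZ2.Cruxes.RectilinearCardy.ExcursionKernelCovariance

open Literature.Probability.LatticeModels Literature.Probability.LatticeModels.CollarLegModel
open Summit.CriticalPhenomena.CardyFormulaZ2.Cruxes.BoundaryDefectGaussianR.RainbowMonomialsInExcursionKernels

/-! ### The walk of the placed datum -/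

section Walk

variable {V : Finset (ℤ × ℤ)} {d₀ : Dart} {iA iB iC : ℕ} {p : Fin 4 → ℤ × ℤ} {ι : LegInsertionData}
  (hv₀ : d₀.1 ∈ V) (ht₀ : dartTip d₀ ∉ V) (hout : outDart V d₀.1 = some d₀)
  (hAB : iA < iB) (hBC : iB < iC) (hCP : iC < period V d₀)
  (hcA : ((neighbours ((dsucc V)^[iA] d₀).1).filter (fun y ↦ y ∉ V)).card = 1)
  (hcB : ((neighbours ((dsucc V)^[iB] d₀).1).filter (fun y ↦ y ∉ V)).card = 1)
  (hcC : ((neighbours ((dsucc V)^[iC] d₀).1).filter (fun y ↦ y ∉ V)).card = 1)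
  (hp : p = ![((dsucc V)^[iC] d₀).1, d₀.1, ((dsucc V)^[iA] d₀).1, ((dsucc V)^[iB] d₀).1])
  (hsrc : ι.source = (Finset.univ.erase 1).image p) (hlegs : ∀ i : Fin 4, i ≠ 1 → ι.legs (p i) = 1)
  (hsink : ι.sink = p 1) (hsl : ι.sinkLegs = 3)
include hv₀ ht₀ hout hAB hBC hCP hcA hcB hcC hp hsrc hlegs hsink hsl

/-- **The insertions met along the cycle**: the sink's `(3, +1)` at position `0`, a source's
`(1, -1)` at positions `iA, iB, iC`, nothing elsewhere. [folklore] -/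
theorem sm_startAt (t : ℕ) (ht : t < period V d₀) :
    ι.startAt V ((dsucc V)^[t] d₀) =
      if t = 0 then some (3, 1) else if t = iA ∨ t = iB ∨ t = iC then some (1, -1) else none := by
  have hP0 : 0 < period V d₀ := by omega
  have hsink' : ι.sink = d₀.1 := by rw [hsink, sm_p_one hp]
  have hcard : ∀ s, s = iA ∨ s = iB ∨ s = iC →
      ((neighbours ((dsucc V)^[s] d₀).1).filter (fun y ↦ y ∉ V)).card = 1 := by
    rintro s (rfl | rfl | rfl)
    exacts [hcA, hcB, hcC]
  unfold LegInsertionData.startAt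
  rw [hsink', hout]
  by_cases h0 : t = 0
  · subst h0
    have h00 : (dsucc V)^[0] d₀ = d₀ := rfl
    rw [h00, if_pos rfl, if_pos rfl, hsl]
  have hne0 : ¬ some d₀ = some ((dsucc V)^[t] d₀) := fun h =>
    h0 (sm_iter_inj hv₀ ht₀ ht hP0 (Option.some.inj h).symm)
  rw [if_neg hne0, if_neg h0]
  by_cases hI : t = iA ∨ t = iB ∨ t = iC
  · -- a source's dart
    rw [if_pos hI]
    have hmem : ((dsucc V)^[t] d₀).1 ∈ ι.source ∧ ι.legs ((dsucc V)^[t] d₀).1 = 1 := by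
      obtain ⟨i, hi1, hit⟩ : ∃ i : Fin 4, i ≠ 1 ∧ p i = ((dsucc V)^[t] d₀).1 := by
        rcases hI with rfl | rfl | rfl
        · exact ⟨2, by decide, by rw [hp]; rfl⟩
        · exact ⟨3, by decide, by rw [hp]; rfl⟩
        · exact ⟨0, by decide, by rw [hp]; rfl⟩
      rw [← hit, hsrc]
      exact ⟨Finset.mem_image_of_mem p (Finset.mem_erase.2 ⟨hi1, Finset.mem_univ i⟩), hlegs i hi1⟩
    rw [if_pos ⟨hmem.1, sm_outDart_iter hv₀ ht₀ t (hcard t hI)⟩, hmem.2]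
  · -- a silent dart
    rw [if_neg hI, if_neg]
    rintro ⟨hs, -⟩
    rw [hsrc] at hs
    obtain ⟨i, hi, hix⟩ := Finset.mem_image.1 hs
    obtain ⟨s, hs3, hps⟩ := sm_p_cases hp i (Finset.mem_erase.1 hi).1
    have hsP : s < period V d₀ := by rcases hs3 with rfl | rfl | rfl <;> omega
    have hts : t = s :=
      sm_idx_eq_of_fst_eq hv₀ ht₀ hsP ht (hcard s hs3) (by rw [← hps, hix])
    exact hI (hts ▸ hs3)

/-- **The states of the annotated walk** are the block states of Part 1. [folklore] -/
theorem sm_walk_state (h2 : 2 ≤ iA) {S : ℕ → WalkState}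
    (hS : ∀ t, S t = if t = 0 then ⟨-3, true, 0, 0⟩ else if t = 1 then ⟨-2, false, 2, 1⟩
      else if t ≤ iA then ⟨0, false, 0, 1⟩ else if t ≤ iB then ⟨-1, true, 0, -1⟩
      else if t ≤ iC then ⟨-2, false, 0, -1⟩ else ⟨-3, true, 0, -1⟩) (t : ℕ) (ht : t ≤ period V d₀) :
    List.foldl (fun s d => s.step (ι.startAt V d)) ι.init ((cycle V d₀).take t) = S t := by
  have hlen : (cycle V d₀).length = period V d₀ := by simp [cycle]
  have hget : ∀ (t : ℕ) (ht : t < (cycle V d₀).length), (cycle V d₀)[t] = (dsucc V)^[t] d₀ := by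
    intro t ht; simp [cycle]
  have hst := sm_startAt hv₀ ht₀ hout hAB hBC hCP hcA hcB hcC hp hsrc hlegs hsink hsl
  rw [sm_init hsl]
  refine sm_foldl_eq hS _ (cycle V d₀) h2 hAB hBC (fun h => ?_) (fun s hs h => ?_)
    (fun s hs ha hb hc hd => ?_) t (hlen ▸ ht)
  · rw [hget 0 h, hst 0 (hlen ▸ h), if_pos rfl]
  · rw [hget s hs, hst s (hlen ▸ hs), if_neg (by omega), if_pos h]
  · rw [hget s hs, hst s (hlen ▸ hs), if_neg ha, if_neg (by omega)]

/-- **The wired sets of the walk, by cycle index.** [folklore] -/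
theorem sm_inWired_iff (h2 : 2 ≤ iA) {S : ℕ → WalkState}
    (hS : ∀ t, S t = if t = 0 then ⟨-3, true, 0, 0⟩ else if t = 1 then ⟨-2, false, 2, 1⟩
      else if t ≤ iA then ⟨0, false, 0, 1⟩ else if t ≤ iB then ⟨-1, true, 0, -1⟩
      else if t ≤ iC then ⟨-2, false, 0, -1⟩ else ⟨-3, true, 0, -1⟩) (ℓ : ℤ) (x : ℤ × ℤ) :
    (∃ t ∈ ι.walk V, t.1.1 = x ∧
        ((t.2.1.wired = true ∧ t.2.1.level = ℓ) ∨ (t.2.2.wired = true ∧ t.2.2.level = ℓ))) ↔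
      ∃ s, s < period V d₀ ∧ ((dsucc V)^[s] d₀).1 = x ∧
        (((S s).wired = true ∧ (S s).level = ℓ) ∨ ((S (s + 1)).wired = true ∧ (S (s + 1)).level = ℓ)) := by
  have hlen : (cycle V d₀).length = period V d₀ := by simp [cycle]
  have hget : ∀ (t : ℕ) (ht : t < (cycle V d₀).length), (cycle V d₀)[t] = (dsucc V)^[t] d₀ := by
    intro t ht; simp [cycle]
  have hW := sm_walk_state hv₀ ht₀ hout hAB hBC hCP hcA hcB hcC hp hsrc hlegs hsink hsl h2 hS
  have hout' : outDart V ι.sink = some d₀ := by rw [hsink, sm_p_one hp]; exact hout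
  constructor
  · rintro ⟨e, he, hex, hw⟩
    obtain ⟨s, hs, rfl⟩ := (mem_walk_iff _ V hout').1 he
    simp only at hex hw
    rw [hget s hs] at hex
    rw [hW s (by omega), hW (s + 1) (by omega)] at hw
    exact ⟨s, hlen ▸ hs, hex, hw⟩
  · rintro ⟨s, hs, hsx, hw⟩
    refine ⟨_, (mem_walk_iff _ V hout').2 ⟨s, hlen.symm ▸ hs, rfl⟩, ?_, ?_⟩
    · simp only; rw [hget]; exact hsx
    · simp only; rw [hW s hs.le, hW (s + 1) (by omega)]; exact hw

/-- **The level `-1` wired set is the vertex block `[iA, iB]` of the cycle.** [folklore] -/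
theorem sm_inWired1_iff (h2 : 2 ≤ iA) (x : ℤ × ℤ) :
    (∃ t ∈ ι.walk V, t.1.1 = x ∧
        ((t.2.1.wired = true ∧ t.2.1.level = -1) ∨ (t.2.2.wired = true ∧ t.2.2.level = -1))) ↔
      ∃ s, iA ≤ s ∧ s ≤ iB ∧ ((dsucc V)^[s] d₀).1 = x := by
  obtain ⟨S, hS⟩ : ∃ S : ℕ → WalkState, ∀ t, S t = if t = 0 then ⟨-3, true, 0, 0⟩
      else if t = 1 then ⟨-2, false, 2, 1⟩ else if t ≤ iA then ⟨0, false, 0, 1⟩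
      else if t ≤ iB then ⟨-1, true, 0, -1⟩ else if t ≤ iC then ⟨-2, false, 0, -1⟩
      else ⟨-3, true, 0, -1⟩ := ⟨_, fun t => rfl⟩
  rw [sm_inWired_iff hv₀ ht₀ hout hAB hBC hCP hcA hcB hcC hp hsrc hlegs hsink hsl h2 hS]
  constructor
  · rintro ⟨s, -, hsx, hw⟩
    obtain ⟨h1, h2'⟩ := (sm_wired1_iff hS h2 hAB hBC s).1 hw
    exact ⟨s, h1, h2', hsx⟩
  · rintro ⟨s, h1, h2', hsx⟩
    exact ⟨s, by omega, hsx, (sm_wired1_iff hS h2 hAB hBC s).2 ⟨h1, h2'⟩⟩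

/-- **The level `-3` wired set is `{X}` together with the final vertex block `[iC, period)`.** [folklore] -/
theorem sm_inWired3_iff (h2 : 2 ≤ iA) (y : ℤ × ℤ) :
    (∃ t ∈ ι.walk V, t.1.1 = y ∧
        ((t.2.1.wired = true ∧ t.2.1.level = -3) ∨ (t.2.2.wired = true ∧ t.2.2.level = -3))) ↔
      y = d₀.1 ∨ ∃ s, iC ≤ s ∧ s < period V d₀ ∧ ((dsucc V)^[s] d₀).1 = y := by
  obtain ⟨S, hS⟩ : ∃ S : ℕ → WalkState, ∀ t, S t = if t = 0 then ⟨-3, true, 0, 0⟩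
      else if t = 1 then ⟨-2, false, 2, 1⟩ else if t ≤ iA then ⟨0, false, 0, 1⟩
      else if t ≤ iB then ⟨-1, true, 0, -1⟩ else if t ≤ iC then ⟨-2, false, 0, -1⟩
      else ⟨-3, true, 0, -1⟩ := ⟨_, fun t => rfl⟩
  rw [sm_inWired_iff hv₀ ht₀ hout hAB hBC hCP hcA hcB hcC hp hsrc hlegs hsink hsl h2 hS]
  constructor
  · rintro ⟨s, hs, hsx, hw⟩
    rcases (sm_wired3_iff hS h2 hAB hBC s).1 hw with rfl | h
    · exact Or.inl hsx.symm
    · exact Or.inr ⟨s, h, hs, hsx⟩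
  · rintro (rfl | ⟨s, h1, hs, hsx⟩)
    · exact ⟨0, by omega, rfl, (sm_wired3_iff hS h2 hAB hBC 0).2 (Or.inl rfl)⟩
    · exact ⟨s, hs, hsx, (sm_wired3_iff hS h2 hAB hBC s).2 (Or.inr h1)⟩

end Walk

/-! ### Paths of live edges -/

/-- A live edge of `V` joins two lattice neighbours, both in `V`. [folklore] -/
theorem sm_edge_adj {V : Finset (ℤ × ℤ)} {e : (ℤ × ℤ) × Bool} (he : e ∈ inducedEdges V) :
    e.1 ∈ V ∧ SixVertex.edgeTip e ∈ V ∧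
      (e.1.1 - (SixVertex.edgeTip e).1) ^ 2 + (e.1.2 - (SixVertex.edgeTip e).2) ^ 2 = 1 := by
  rw [inducedEdges, Finset.mem_filter] at he
  refine ⟨he.2.1, he.2.2, ?_⟩
  unfold SixVertex.edgeTip
  split_ifs <;> simp

/-- One step of a path of live edges `ω ⊆ E(V)` joins two lattice neighbours, both in `V`. [folklore] -/
theorem sm_step_adj {V : Finset (ℤ × ℤ)} {ω : Finset ((ℤ × ℤ) × Bool)} (hω : ω ⊆ inducedEdges V)
    {b c : ℤ × ℤ}
    (h : ∃ e ∈ ω, (e.1 = b ∧ SixVertex.edgeTip e = c) ∨ (e.1 = c ∧ SixVertex.edgeTip e = b)) :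
    b ∈ V ∧ c ∈ V ∧ (b.1 - c.1) ^ 2 + (b.2 - c.2) ^ 2 = 1 ∧ (c.1 - b.1) ^ 2 + (c.2 - b.2) ^ 2 = 1 := by
  obtain ⟨e, he, h⟩ := h
  obtain ⟨h1, h2, h3⟩ := sm_edge_adj (hω he)
  have h3' : ((SixVertex.edgeTip e).1 - e.1.1) ^ 2 + ((SixVertex.edgeTip e).2 - e.1.2) ^ 2 = 1 := by
    rw [← h3]; ring
  rcases h with ⟨rfl, rfl⟩ | ⟨rfl, rfl⟩
  · exact ⟨h1, h2, h3, h3'⟩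
  · exact ⟨h2, h1, h3', h3⟩

/-! ### Abstract matching: corners carry no connectivity -/

/-- **Abstract matching of hull events.** Let `r` be a step relation joining lattice neighbours in
`V`, `RA ⊆ W₁` and `RB ⊆ W₃` "row sets" inside two "wired sets" such that every vertex of `W₁ ∖ RA`
differs from `v'` and from `W₃` and has all its `V`-neighbours in `RA`, and every vertex of
`W₃ ∖ RB` differs from `RA` and has all its `V`-neighbours in `RB`. Then `v'` is `r`-joined to `W₁`
but `W₃` is not, iff `v'` is `r`-joined to `RA` but `RB` is not. [folklore] -/
theorem sm_hull_iff :
    ∀ (V : Finset (ℤ × ℤ)) (r : ℤ × ℤ → ℤ × ℤ → Prop) (W1 W3 : ℤ × ℤ → Prop) (RA RB : Finset (ℤ × ℤ))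
      (v' : ℤ × ℤ),
      (∀ b c, r b c → b ∈ V ∧ c ∈ V ∧ (b.1 - c.1) ^ 2 + (b.2 - c.2) ^ 2 = 1 ∧
        (c.1 - b.1) ^ 2 + (c.2 - b.2) ^ 2 = 1) →
      (∀ x ∈ RA, W1 x) → (∀ y ∈ RB, W3 y) →
      (∀ x, W1 x → x ∉ RA → x ≠ v' ∧ (∀ y, W3 y → y ≠ x) ∧
        ∀ w ∈ V, (w.1 - x.1) ^ 2 + (w.2 - x.2) ^ 2 = 1 → w ∈ RA) →
      (∀ y, W3 y → y ∉ RB → (∀ x ∈ RA, y ≠ x) ∧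
        ∀ w ∈ V, (w.1 - y.1) ^ 2 + (w.2 - y.2) ^ 2 = 1 → w ∈ RB) →
      (((∃ x, W1 x ∧ Relation.ReflTransGen r v' x) ∧
          ¬ (∃ y, W3 y ∧ ∃ x, W1 x ∧ Relation.ReflTransGen r y x)) ↔
        ((∃ x ∈ RA, Relation.ReflTransGen r v' x) ∧
          ¬ (∃ y ∈ RB, ∃ x ∈ RA, Relation.ReflTransGen r y x))) := by
  intro V r W1 W3 RA RB v' hr hA hB hA' hB'
  -- a path to a vertex of `W₁` reaches `RA`: peel its last step if it ends at a corner
  have tailA : ∀ a x, Relation.ReflTransGen r a x → W1 x → a ≠ x →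
      ∃ w ∈ RA, Relation.ReflTransGen r a w := by
    intro a x hax hx hne
    by_cases hxA : x ∈ RA
    · exact ⟨x, hxA, hax⟩
    obtain ⟨-, -, hnb⟩ := hA' x hx hxA
    rcases (Relation.ReflTransGen.cases_tail_iff r a x).1 hax with h | ⟨w, haw, hwx⟩
    · exact absurd h.symm hne
    obtain ⟨hwV, -, hd, -⟩ := hr w x hwx
    exact ⟨w, hnb w hwV hd, haw⟩
  constructor
  · rintro ⟨⟨x, hx, hvx⟩, hneg⟩
    refine ⟨?_, ?_⟩
    · by_cases hxA : x ∈ RA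
      · exact ⟨x, hxA, hvx⟩
      · exact tailA v' x hvx hx (hA' x hx hxA).1.symm
    · rintro ⟨y, hy, x, hxA, hyx⟩
      exact hneg ⟨y, hB y hy, x, hA x hxA, hyx⟩
  · rintro ⟨⟨x, hxA, hvx⟩, hneg⟩
    refine ⟨⟨x, hA x hxA, hvx⟩, ?_⟩
    rintro ⟨y, hy, x, hx, hyx⟩
    -- the far end may be taken in `RA`
    obtain ⟨w, hwA, hyw⟩ : ∃ w ∈ RA, Relation.ReflTransGen r y w := by
      by_cases hxA : x ∈ RA
      · exact ⟨x, hxA, hyx⟩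
      · exact tailA y x hyx hx ((hA' x hx hxA).2.1 y hy)
    -- the near end may be taken in `RB`: peel the first step if it starts at a corner
    by_cases hyB : y ∈ RB
    · exact hneg ⟨y, hyB, w, hwA, hyw⟩
    obtain ⟨hne, hnb⟩ := hB' y hy hyB
    rcases hyw.cases_head with h | ⟨w', hyw', hw'w⟩
    · exact hne w hwA h
    obtain ⟨-, hw'V, -, hd⟩ := hr y w' hyw'
    exact hneg ⟨w', hnb w' hw'V hd, w, hwA, hw'w⟩

/-! ### The registered stub -/

/-- **Stub M — MATCHING (L; geometry-free walk/graph combinatorics).** On a boundary cycle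
`e i = dsucc^[i] d₀` with blocks as delivered by stub B (abstract row sets `RA`, `RB`), the placement
`p = (C, X, A, B) = ((e iC).1, d₀.1, (e iA).1, (e iB).1)` is injective and ADMISSIBLE for the
`(1,3,1,1; 1)` datum (`s3_admissible_of_dist`: met by the cycle, `ℓ∞`-separated by `≥ 3 = sinkLegs`),
its sink dart is `d₀`, and for every `ω ⊆ E` the walk's hull event (jump vertex `(dsucc d₀).1 = v'`
joined to the level `-1` wired set, level `-3` wired set not joined to it) is the row event
(`v' ↔ RA`, `RB ↮ RA`): the wired sets of the walk are the vertex sets of the blocks (`getElem?_walk`,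
`mem_walk_iff`, the level bookkeeping of `WalkState.step` with insertions at indices `0, iA, iB, iC`),
and block vertices off the row sets are corners whose polygon neighbours lie in the row sets, so they
carry no connectivity. [folklore] -/
theorem stub_matching :
    ∀ (V : Finset (ℤ × ℤ)) (d₀ : Literature.Probability.LatticeModels.CollarLegModel.Dart) (iA iB iC : ℕ) (v' : ℤ × ℤ) (RA RB : Finset (ℤ × ℤ)),
      ((d₀.1 ∈ V ∧ Literature.Probability.LatticeModels.CollarLegModel.dartTip d₀ ∉ V ∧ Literature.Probability.LatticeModels.CollarLegModel.outDart V d₀.1 = some d₀) ∧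
            ((Literature.Probability.LatticeModels.CollarLegModel.dsucc V d₀).1 = v') ∧
            (2 ≤ iA ∧ iA ≤ iB ∧ iB + 2 ≤ iC ∧ iC + 2 ≤ Literature.Probability.LatticeModels.CollarLegModel.period V d₀) ∧
            (((Literature.Probability.LatticeModels.CollarLegModel.neighbours d₀.1).filter (fun y ↦ y ∉ V)).card = 1 ∧ ((Literature.Probability.LatticeModels.CollarLegModel.neighbours ((Literature.Probability.LatticeModels.CollarLegModel.dsucc V)^[iA] d₀).1).filter (fun y ↦ y ∉ V)).card = 1 ∧ ((Literature.Probability.LatticeModels.CollarLegModel.neighbours ((Literature.Probability.LatticeModels.CollarLegModel.dsucc V)^[iB] d₀).1).filter (fun y ↦ y ∉ V)).card = 1 ∧ ((Literature.Probability.LatticeModels.CollarLegModel.neighbours ((Literature.Probability.LatticeModels.CollarLegModel.dsucc V)^[iC] d₀).1).filter (fun y ↦ y ∉ V)).card = 1 ∧ ((Literature.Probability.LatticeModels.CollarLegModel.neighbours v').filter (fun y ↦ y ∉ V)).card = 1) ∧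
            ((3 : ℤ) ≤ max |(d₀.1).1 - (((Literature.Probability.LatticeModels.CollarLegModel.dsucc V)^[iA] d₀).1).1| |(d₀.1).2 - (((Literature.Probability.LatticeModels.CollarLegModel.dsucc V)^[iA] d₀).1).2| ∧ (3 : ℤ) ≤ max |(d₀.1).1 - (((Literature.Probability.LatticeModels.CollarLegModel.dsucc V)^[iB] d₀).1).1| |(d₀.1).2 - (((Literature.Probability.LatticeModels.CollarLegModel.dsucc V)^[iB] d₀).1).2| ∧ (3 : ℤ) ≤ max |(d₀.1).1 - (((Literature.Probability.LatticeModels.CollarLegModel.dsucc V)^[iC] d₀).1).1| |(d₀.1).2 - (((Literature.Probability.LatticeModels.CollarLegModel.dsucc V)^[iC] d₀).1).2| ∧ (3 : ℤ) ≤ max |(((Literature.Probability.LatticeModels.CollarLegModel.dsucc V)^[iA] d₀).1).1 - (((Literature.Probability.LatticeModels.CollarLegModel.dsucc V)^[iB] d₀).1).1| |(((Literature.Probability.LatticeModels.CollarLegModel.dsucc V)^[iA] d₀).1).2 - (((Literature.Probability.LatticeModels.CollarLegModel.dsucc V)^[iB] d₀).1).2| ∧ (3 : ℤ) ≤ max |(((Literature.Probability.LatticeModels.CollarLegModel.dsucc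 V)^[iA] d₀).1).1 - (((Literature.Probability.LatticeModels.CollarLegModel.dsucc V)^[iC] d₀).1).1| |(((Literature.Probability.LatticeModels.CollarLegModel.dsucc V)^[iA] d₀).1).2 - (((Literature.Probability.LatticeModels.CollarLegModel.dsucc V)^[iC] d₀).1).2| ∧ (3 : ℤ) ≤ max |(((Literature.Probability.LatticeModels.CollarLegModel.dsucc V)^[iB] d₀).1).1 - (((Literature.Probability.LatticeModels.CollarLegModel.dsucc V)^[iC] d₀).1).1| |(((Literature.Probability.LatticeModels.CollarLegModel.dsucc V)^[iB] d₀).1).2 - (((Literature.Probability.LatticeModels.CollarLegModel.dsucc V)^[iC] d₀).1).2|) ∧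
            (∀ x : ℤ × ℤ, x ∈ RA ↔
              ∃ i : ℕ, iA ≤ i ∧ i ≤ iB ∧ ((Literature.Probability.LatticeModels.CollarLegModel.dsucc V)^[i] d₀).1 = x ∧ ((Literature.Probability.LatticeModels.CollarLegModel.neighbours ((Literature.Probability.LatticeModels.CollarLegModel.dsucc V)^[i] d₀).1).filter (fun y ↦ y ∉ V)).card = 1) ∧
            (∀ x : ℤ × ℤ, x ∈ RB ↔
              (∃ i : ℕ, iC ≤ i ∧ i < Literature.Probability.LatticeModels.CollarLegModel.period V d₀ ∧ ((Literature.Probability.LatticeModels.CollarLegModel.dsucc V)^[i] d₀).1 = x ∧ ((Literature.Probability.LatticeModels.CollarLegModel.neighbours ((Literature.Probability.LatticeModels.CollarLegModel.dsucc V)^[i] d₀).1).filter (fun y ↦ y ∉ V)).card = 1) ∨ x = d₀.1) ∧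
            (∀ i : ℕ, iA ≤ i → i ≤ iB → ((Literature.Probability.LatticeModels.CollarLegModel.neighbours ((Literature.Probability.LatticeModels.CollarLegModel.dsucc V)^[i] d₀).1).filter (fun y ↦ y ∉ V)).card ≠ 1 →
              ∀ w ∈ V, (w.1 - ((Literature.Probability.LatticeModels.CollarLegModel.dsucc V)^[i] d₀).1.1) ^ 2 + (w.2 - ((Literature.Probability.LatticeModels.CollarLegModel.dsucc V)^[i] d₀).1.2) ^ 2 = 1 → w ∈ RA) ∧
            (∀ i : ℕ, iC ≤ i → i < Literature.Probability.LatticeModels.CollarLegModel.period V d₀ → ((Literature.Probability.LatticeModels.CollarLegModel.neighbours ((Literature.Probability.LatticeModels.CollarLegModel.dsucc V)^[i] d₀).1).filter (fun y ↦ y ∉ V)).card ≠ 1 →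
              ∀ w ∈ V, (w.1 - ((Literature.Probability.LatticeModels.CollarLegModel.dsucc V)^[i] d₀).1.1) ^ 2 + (w.2 - ((Literature.Probability.LatticeModels.CollarLegModel.dsucc V)^[i] d₀).1.2) ^ 2 = 1 → w ∈ RB) ∧
            (∀ i : ℕ, iA ≤ i → i ≤ iB → ((Literature.Probability.LatticeModels.CollarLegModel.dsucc V)^[i] d₀).1 ≠ v' ∧ ((Literature.Probability.LatticeModels.CollarLegModel.dsucc V)^[i] d₀).1 ≠ d₀.1 ∧
              ∀ j : ℕ, iC ≤ j → j < Literature.Probability.LatticeModels.CollarLegModel.period V d₀ → ((Literature.Probability.LatticeModels.CollarLegModel.dsucc V)^[i] d₀).1 ≠ ((Literature.Probability.LatticeModels.CollarLegModel.dsucc V)^[j] d₀).1) ∧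
            (d₀.1 ≠ v')) →
      Function.Injective (![((Literature.Probability.LatticeModels.CollarLegModel.dsucc V)^[iC] d₀).1, d₀.1, ((Literature.Probability.LatticeModels.CollarLegModel.dsucc V)^[iA] d₀).1, ((Literature.Probability.LatticeModels.CollarLegModel.dsucc V)^[iB] d₀).1] : Fin 4 → ℤ × ℤ) ∧
      Literature.Probability.LatticeModels.CollarLegModel.LegInsertionData.IsAdmissible (⟨(Finset.univ.erase 1).image (![((Literature.Probability.LatticeModels.CollarLegModel.dsucc V)^[iC] d₀).1, d₀.1, ((Literature.Probability.LatticeModels.CollarLegModel.dsucc V)^[iA] d₀).1, ((Literature.Probability.LatticeModels.CollarLegModel.dsucc V)^[iB] d₀).1] : Fin 4 → ℤ × ℤ), fun x ↦ ∑ i ∈ (Finset.univ.erase 1).filter (fun i ↦ (![((Literature.Probability.LatticeModels.CollarLegModel.dsucc V)^[iC] d₀).1, d₀.1, ((Literature.Probability.LatticeModels.CollarLegModel.dsucc V)^[iA] d₀).1, ((Literature.Probability.LatticeModels.CollarLegModel.dsucc V)^[iB] d₀).1] : Fin 4 → ℤ × ℤ) i = x), (![1, 3, 1, 1] : Fin 4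 → ℕ) i, (![((Literature.Probability.LatticeModels.CollarLegModel.dsucc V)^[iC] d₀).1, d₀.1, ((Literature.Probability.LatticeModels.CollarLegModel.dsucc V)^[iA] d₀).1, ((Literature.Probability.LatticeModels.CollarLegModel.dsucc V)^[iB] d₀).1] : Fin 4 → ℤ × ℤ) 1⟩ : Literature.Probability.LatticeModels.CollarLegModel.LegInsertionData) V ∧
      Literature.Probability.LatticeModels.CollarLegModel.outDart V ((![((Literature.Probability.LatticeModels.CollarLegModel.dsucc V)^[iC] d₀).1, d₀.1, ((Literature.Probability.LatticeModels.CollarLegModel.dsucc V)^[iA] d₀).1, ((Literature.Probability.LatticeModels.CollarLegModel.dsucc V)^[iB] d₀).1] : Fin 4 → ℤ × ℤ) 1) = some d₀ ∧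
      ∀ ω : Finset ((ℤ × ℤ) × Bool), ω ⊆ Literature.Probability.LatticeModels.CollarLegModel.inducedEdges V →
        (((∃ x : ℤ × ℤ, (∃ t ∈ (⟨(Finset.univ.erase 1).image (![((Literature.Probability.LatticeModels.CollarLegModel.dsucc V)^[iC] d₀).1, d₀.1, ((Literature.Probability.LatticeModels.CollarLegModel.dsucc V)^[iA] d₀).1, ((Literature.Probability.LatticeModels.CollarLegModel.dsucc V)^[iB] d₀).1] : Fin 4 → ℤ × ℤ), fun x ↦ ∑ i ∈ (Finset.univ.erase 1).filter (fun i ↦ (![((Literature.Probability.LatticeModels.CollarLegModel.dsucc V)^[iC] d₀).1, d₀.1, ((Literature.Probability.LatticeModels.CollarLegModel.dsucc V)^[iA] d₀).1, ((Literature.Probability.LatticeModels.CollarLegModel.dsucc V)^[iB] d₀).1] : Fin 4 → ℤ × ℤ) i = x), (![1, 3, 1, 1] : Fin 4 → ℕ) i, (![((Literature.Probability.LatticeModels.CollarLegModel.dsucc V)^[iC] d₀).1, d₀.1, ((Literature.Probability.LatticeModels.CollarLegModel.dsucc V)^[iA] d₀).1, ((Literature.Probability.LatticeModels.CollarLegModel.dsucc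 V)^[iB] d₀).1] : Fin 4 → ℤ × ℤ) 1⟩ : Literature.Probability.LatticeModels.CollarLegModel.LegInsertionData).walk V, t.1.1 = x ∧ ((t.2.1.wired = true ∧ t.2.1.level = -1) ∨ (t.2.2.wired = true ∧ t.2.2.level = -1))) ∧
              Relation.ReflTransGen (fun b c : ℤ × ℤ ↦ ∃ e ∈ ω,
                (e.1 = b ∧ Literature.Probability.LatticeModels.SixVertex.edgeTip e = c) ∨
                  (e.1 = c ∧ Literature.Probability.LatticeModels.SixVertex.edgeTip e = b)) (Literature.Probability.LatticeModels.CollarLegModel.dsucc V d₀).1 x) ∧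
            ¬ (∃ y : ℤ × ℤ, (∃ t ∈ (⟨(Finset.univ.erase 1).image (![((Literature.Probability.LatticeModels.CollarLegModel.dsucc V)^[iC] d₀).1, d₀.1, ((Literature.Probability.LatticeModels.CollarLegModel.dsucc V)^[iA] d₀).1, ((Literature.Probability.LatticeModels.CollarLegModel.dsucc V)^[iB] d₀).1] : Fin 4 → ℤ × ℤ), fun x ↦ ∑ i ∈ (Finset.univ.erase 1).filter (fun i ↦ (![((Literature.Probability.LatticeModels.CollarLegModel.dsucc V)^[iC] d₀).1, d₀.1, ((Literature.Probability.LatticeModels.CollarLegModel.dsucc V)^[iA] d₀).1, ((Literature.Probability.LatticeModels.CollarLegModel.dsucc V)^[iB] d₀).1] : Fin 4 → ℤ × ℤ) i = x), (![1, 3, 1, 1] : Fin 4 → ℕ) i, (![((Literature.Probability.LatticeModels.CollarLegModel.dsucc V)^[iC] d₀).1, d₀.1, ((Literature.Probability.LatticeModels.CollarLegModel.dsucc V)^[iA] d₀).1, ((Literature.Probability.LatticeModels.CollarLegModel.dsucc V)^[iB] d₀).1] : Fin 4 → ℤ × ℤ) 1⟩ : Literature.Probability.LatticeModels.CollarLegModel.LegInsertionData).walk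 V, t.1.1 = y ∧ ((t.2.1.wired = true ∧ t.2.1.level = -3) ∨ (t.2.2.wired = true ∧ t.2.2.level = -3))) ∧
                ∃ x : ℤ × ℤ, (∃ t ∈ (⟨(Finset.univ.erase 1).image (![((Literature.Probability.LatticeModels.CollarLegModel.dsucc V)^[iC] d₀).1, d₀.1, ((Literature.Probability.LatticeModels.CollarLegModel.dsucc V)^[iA] d₀).1, ((Literature.Probability.LatticeModels.CollarLegModel.dsucc V)^[iB] d₀).1] : Fin 4 → ℤ × ℤ), fun x ↦ ∑ i ∈ (Finset.univ.erase 1).filter (fun i ↦ (![((Literature.Probability.LatticeModels.CollarLegModel.dsucc V)^[iC] d₀).1, d₀.1, ((Literature.Probability.LatticeModels.CollarLegModel.dsucc V)^[iA] d₀).1, ((Literature.Probability.LatticeModels.CollarLegModel.dsucc V)^[iB] d₀).1] : Fin 4 → ℤ × ℤ) i = x), (![1, 3, 1, 1] : Fin 4 → ℕ) i, (![((Literature.Probability.LatticeModels.CollarLegModel.dsucc V)^[iC] d₀).1, d₀.1, ((Literature.Probability.LatticeModels.CollarLegModel.dsucc V)^[iA] d₀).1, ((Literature.Probability.LatticeModels.CollarLegModel.dsucc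 V)^[iB] d₀).1] : Fin 4 → ℤ × ℤ) 1⟩ : Literature.Probability.LatticeModels.CollarLegModel.LegInsertionData).walk V, t.1.1 = x ∧ ((t.2.1.wired = true ∧ t.2.1.level = -1) ∨ (t.2.2.wired = true ∧ t.2.2.level = -1))) ∧
                  Relation.ReflTransGen (fun b c : ℤ × ℤ ↦ ∃ e ∈ ω,
                (e.1 = b ∧ Literature.Probability.LatticeModels.SixVertex.edgeTip e = c) ∨
                  (e.1 = c ∧ Literature.Probability.LatticeModels.SixVertex.edgeTip e = b)) y x)) ↔
          ((∃ x ∈ RA, Relation.ReflTransGen (fun b c : ℤ × ℤ ↦ ∃ e ∈ ω,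
                (e.1 = b ∧ Literature.Probability.LatticeModels.SixVertex.edgeTip e = c) ∨
                  (e.1 = c ∧ Literature.Probability.LatticeModels.SixVertex.edgeTip e = b)) v' x) ∧
            ¬ (∃ y ∈ RB, ∃ x ∈ RA, Relation.ReflTransGen (fun b c : ℤ × ℤ ↦ ∃ e ∈ ω,
                (e.1 = b ∧ Literature.Probability.LatticeModels.SixVertex.edgeTip e = c) ∨
                  (e.1 = c ∧ Literature.Probability.LatticeModels.SixVertex.edgeTip e = b)) y x)))  := by
  intro V d₀ iA iB iC v' RA RB h
  obtain ⟨⟨hv₀, ht₀, hout⟩, hv', ⟨h2, hAB, hBC, hCP⟩, ⟨hcX, hcA, hcB, hcC, -⟩, ⟨s1, s2, s3, s4, s5, s6⟩,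
    hRA, hRB, hcorA, hcorB, hdisj, -⟩ := h
  subst hv'
  -- name the placement and the datum
  set p : Fin 4 → ℤ × ℤ := ![((dsucc V)^[iC] d₀).1, d₀.1, ((dsucc V)^[iA] d₀).1, ((dsucc V)^[iB] d₀).1]
    with hp
  set ι : LegInsertionData := (⟨(Finset.univ.erase 1).image p,
    fun x ↦ ∑ i ∈ (Finset.univ.erase 1).filter (fun i ↦ p i = x), (![1, 3, 1, 1] : Fin 4 → ℕ) i, p 1⟩ :
      LegInsertionData) with hι
  have hsep := sm_sep hp s1 s2 s3 s4 s5 s6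
  have hinj := sm_injective hsep
  -- the fields of the datum
  have hsrc : ι.source = (Finset.univ.erase 1).image p := by rw [hι]
  have hsink : ι.sink = p 1 := by rw [hι]
  have hsl : ι.sinkLegs = 3 := by rw [hι]; exact sm_sinkLegs p
  have hlegs : ∀ i : Fin 4, i ≠ 1 → ι.legs (p i) = 1 := fun i hi => by rw [hι]; exact sm_legs p hinj i hi
  -- the indices are strictly ordered (`A ≠ B` by separation)
  have hAB' : iA < iB := by
    refine lt_of_le_of_ne hAB ?_
    rintro rfl
    simp at s4
  have hBC' : iB < iC := by omega
  have hCP' : iC < period V d₀ := by omega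
  refine ⟨hinj, sm_admissible V d₀ iA iB iC p ι hv₀ ht₀ hout hcX hcA hcB hcC hp hsep hsrc hlegs hsink hsl,
    by rw [sm_p_one hp]; exact hout, fun ω hω => ?_⟩
  -- the wired sets of the walk are the vertex blocks
  have hW1 : ∀ x, (∃ t ∈ ι.walk V, t.1.1 = x ∧
      ((t.2.1.wired = true ∧ t.2.1.level = -1) ∨ (t.2.2.wired = true ∧ t.2.2.level = -1))) ↔
      ∃ s, iA ≤ s ∧ s ≤ iB ∧ ((dsucc V)^[s] d₀).1 = x :=
    fun x => sm_inWired1_iff hv₀ ht₀ hout hAB' hBC' hCP' hcA hcB hcC hp hsrc hlegs hsink hsl h2 x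
  have hW3 : ∀ y, (∃ t ∈ ι.walk V, t.1.1 = y ∧
      ((t.2.1.wired = true ∧ t.2.1.level = -3) ∨ (t.2.2.wired = true ∧ t.2.2.level = -3))) ↔
      y = d₀.1 ∨ ∃ s, iC ≤ s ∧ s < period V d₀ ∧ ((dsucc V)^[s] d₀).1 = y :=
    fun y => sm_inWired3_iff hv₀ ht₀ hout hAB' hBC' hCP' hcA hcB hcC hp hsrc hlegs hsink hsl h2 y
  refine sm_hull_iff V _
    (fun x => ∃ t ∈ ι.walk V, t.1.1 = x ∧
      ((t.2.1.wired = true ∧ t.2.1.level = -1) ∨ (t.2.2.wired = true ∧ t.2.2.level = -1)))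
    (fun y => ∃ t ∈ ι.walk V, t.1.1 = y ∧
      ((t.2.1.wired = true ∧ t.2.1.level = -3) ∨ (t.2.2.wired = true ∧ t.2.2.level = -3)))
    RA RB _ (fun b c hbc => sm_step_adj hω hbc) (fun x hx => ?_) (fun y hy => ?_) (fun x hx hxA => ?_)
    (fun y hy hyB => ?_)
  · -- `RA ⊆ W₁`
    obtain ⟨i, h1, h2', h3, -⟩ := (hRA x).1 hx
    exact (hW1 x).2 ⟨i, h1, h2', h3⟩
  · -- `RB ⊆ W₃`
    rcases (hRB y).1 hy with ⟨i, h1, h2', h3, -⟩ | h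
    · exact (hW3 y).2 (Or.inr ⟨i, h1, h2', h3⟩)
    · exact (hW3 y).2 (Or.inl h)
  · -- corners of block 1: off `v'`, off block 2, all `V`-neighbours in `RA`
    obtain ⟨i, hiA, hiB, rfl⟩ := (hW1 x).1 hx
    have hci : ((neighbours ((dsucc V)^[i] d₀).1).filter (fun y ↦ y ∉ V)).card ≠ 1 :=
      fun hc => hxA ((hRA _).2 ⟨i, hiA, hiB, rfl, hc⟩)
    obtain ⟨hne1, hne2, hne3⟩ := hdisj i hiA hiB
    refine ⟨hne1, fun y hy => ?_, fun w hw hadj => hcorA i hiA hiB hci w hw hadj⟩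
    rcases (hW3 y).1 hy with rfl | ⟨j, hjC, hjP, rfl⟩
    · exact hne2.symm
    · exact (hne3 j hjC hjP).symm
  · -- corners of block 2: off `RA`, all `V`-neighbours in `RB`
    rcases (hW3 y).1 hy with rfl | ⟨j, hjC, hjP, rfl⟩
    · exact absurd ((hRB _).2 (Or.inr rfl)) hyB
    have hcj : ((neighbours ((dsucc V)^[j] d₀).1).filter (fun y ↦ y ∉ V)).card ≠ 1 :=
      fun hc => hyB ((hRB _).2 (Or.inl ⟨j, hjC, hjP, rfl, hc⟩))
    refine ⟨fun x hx => ?_, fun w hw hadj => hcorB j hjC hjP hcj w hw hadj⟩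
    obtain ⟨i, hiA, hiB, rfl, -⟩ := (hRA x).1 hx
    exact ((hdisj i hiA hiB).2.2 j hjC hjP).symm

end Summit.CriticalPhenomena.CardyFormulaZ2.Cruxes.RectilinearCardy.ExcursionKernelCovariance
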